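import Summits.SmoothPoincare4.SmoothPoincare4.Theorems.EntropyRungNoncompactGapReduction
import Summits.SmoothPoincare4.SmoothPoincare4.Theorems.EntropyRungNoncompactShrinkerGapStubCompactSupportLSIHeat
import Summits.SmoothPoincare4.SmoothPoincare4.Theorems.EntropyRungNoncompactShrinkerGapThreeShrinkerRicciNonneg
import Literature.Geometry.Riemannian.RicciNonnegInfiniteVolumeProofs

/-!
# Crux `EntropyRung.NoncompactShrinkerGap` (stmt-SmoothPoincare4-10868) — line `collapsed-ends-usc`, skeleton v20

Lead c15, v20 (2026-08-17, later the same cycle; stubs and composition still UNCHANGED from v17): bricks 3a–3c of 16588's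
printed chain are theorems too — the global gradient flow θ of `∇f` (`helper_shrinkerGradientFlow`, p167180), the canonical
ancient TYPE-I Ricci flow `G t = (1−t)ψ_t^*g`, `ψ_t = θ(−log(1−t),·)` with `IsRicciFlow G cov (Iio 1)`, `Ric_{cov t} = ψ_t^*Ric_g`,
`|Rm_{G t}| ≤ C/(1−t)` (`helper_shrinkerCanonicalFlow_of` p168051, `helper_shrinkerCanonicalFlow` p168698; Naber 2010 L1.1 via
Topping Prop 1.2.1), and the essential blow-up sequence `q_k → q*`, `τ_k → ∞`, `R_g(θ(τ_k,q_k)) ≥ ε` from non-decaying `R`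
(`helper_shrinkerEssentialBlowupSequence` p168656; EMT11 Def 1.2); in dimension 4 all of it, with c14's frame bound and c15's κ, is
`helper_fourShrinkerTypeIBlowupPackage` (Theorems/EntropyRungNoncompactShrinkerGapTypeIBlowupPackage.lean) under exactly the hypotheses of
`shrinkerSplittingAtInfinity_four`. What 16588 still needs: EMT11 Thm 1.4 at `q*` (pointed CG–Hamilton compactness of complete slices +
reduced volume) and Naber L4.1 given the limit.

Lead c15, v19 (2026-08-17; stubs and composition UNCHANGED from v17 — `sorry` only in the three route-item stubs
16588/16589/16590): brick 2 of the printed chain of `stub_splittingAtInfinity` (item 16588) — PERELMAN'S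
κ-NONCOLLAPSING OF A COMPLETE GRADIENT SHRINKER WITH BOUNDED SCALAR CURVATURE, uniform in the base point, at all
scales `≤ 1` (`∃ κ > 0 ∀ x ∀ s ∈ (0,1], κ sⁿ ≤ Vol B(x,s)`; the input of Hamilton–Cheeger–Gromov compactness at the
escaping base points) — is assembled in `Summit.SmoothPoincare4.SmoothPoincare4.Theorems.NoncompactShrinkerGapNoncollapsing`
(`helper_shrinkerNoncollapsing`, Theorems/EntropyRungNoncompactShrinkerGapNoncollapsing.lean) from four landed helper
stubs: `helper_lipschitzSmoothingCompactSupport` (p163631), `helper_metricCutoffComplete_of` (p163923, Topping's cut-off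
on complete manifolds), `helper_csLSI_allScales` (p164618, Li–Wang 2020 Thm 1.1 in compact-support 𝒲-form at every
scale, from the discharged `liWang2020_shrinkerLSI_allScales_holds`), `helper_csEntropy_cutoff_le_of_integrableOn`
(p165645, Topping's Lemma 8.3.5 in compact-support form), the tree's halving iteration
`ofReal_mul_pow_le_vol_ball_of_doubling` and `0 ≤ R ≤ A` only (no `|Rm|` bound is used).


Lead c14, v18 (2026-08-17; stubs and composition UNCHANGED from v17 — `sorry` only in the three route-item stubs
16588/16589/16590): brick 1 of the printed chain of `stub_splittingAtInfinity` (item 16588 = named fact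
`shrinkerSplittingAtInfinity_four`) is now a THEOREM of the tree — Munteanu–Wang 2015, Prop. 1.3 / Thm. 1.4 (first
half): `Literature.Geometry.Riemannian.FourShrinker.normSq_ricci_bounded` and `FourShrinker.curvNormSq_bounded`
(`Literature/Geometry/Riemannian/FourShrinkerCurvatureBounded.lean`, p144508: a complete connected 4-d gradient shrinker
with `R ≤ A` has bounded `|Ric|²_g`, `|Rm|²_g`; inputs `CoordShrinkerCurvatureGradientBound` (Prop 1.1),
`CoordShrinkerRicciNormSqDrift` ((1.10)), `CoordShrinkerRicciPinching` (Lemma 1.2 at a point), `CoordShrinkerRmNormSqDrift`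
((id)+Kato), `CoordShrinkerRmDrift`, `ShrinkerPotentialProper`, `ShrinkerLocalisedMaximumPrinciple`,
`FourShrinkerCurvatureBoundedOf`); the `|∇Rm|` half is assembled modulo registered stubs in
`FourShrinkerCovariantCurvatureBoundedOf.lean` (p144463). Also the named fact `LiWang2020_shrinkerLSI_allScales` is
discharged (`liWang2020_shrinkerLSI_allScales_holds`, Theorems/EntropyRungNoncompactShrinkerGapLiWangAllScales.lean,
p143767). What 16588 still needs: the soliton's canonical flow, non-collapsing, Hamilton–Cheeger–Gromov compactness for a
complete NON-compact slice (not vended), the EMT shrinker limit, Naber's splitting — see Cruxes/…/NOTES.md (c14).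

Lead c13, v17 (2026-08-17): `stub_infiniteVolume` of v16 — Calabi–Yau 1976, a complete connected noncompact
Riemannian manifold with `Ric ≥ 0` has infinite volume — is a THEOREM of the tree:
`Literature.Geometry.Riemannian.ricciNonneg_infiniteVolume_holds` (`RicciNonnegInfiniteVolumeProofs.lean`,
literature seat, Bishop–Gromov in geodesic polar coordinates; independently this line's programme landed the
area formula for `exp_p` — `RiemVolumeImageLe/Eq.lean`, `JacobianChartFormula.lean` — the explicit normal Jacobi
tensor and the Gram determinant of `d exp_p` — `NormalJacobiTensorExplicit.lean`, `ExpMapGramDeterminant.lean` —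
Bishop's radial antitonicity `ExpMapJacobianAntitone.lean` and Yau's argument by homothety
`RicciNonnegInfiniteVolumeOfBishop.lean`, `ricciNonneg_infiniteVolume_of_antitone`). Hence the 3-d rung
`stub_threeShrinkerGap` (= route item 16586 `ThreeShrinkerGap`) is an UNCONDITIONAL theorem
(`threeShrinkerClassification_modelData_holds`, `ThreeShrinkerClassificationHolds.lean`), and `sorry` lives only
in the three route-item stubs `stub_splittingAtInfinity` (16588, XL named fact), `stub_conicalGap` (16589, open
problem), `stub_unboundedCurvatureGap` (16590, no theorem in print). `NoncompactShrinkerGap_of` is unchanged.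

Lead c12, v16 (2026-08-17): the three steps of (F2) = Munteanu–Wang 2017 Thm 2 for n = 3 are now theorems of the tree
(`ThreeShrinker.ricci_ge_div_potential`, `scalarCurvature_ge_log`, `riemVolume_univ_lt_top_of_scalarCurvature_ge`,
assembled in `ThreeShrinker.exists_ricci_null_of_infiniteVolume` / `threeShrinkerClassification_modelData_of_infiniteVolume`),
so `stub_F2` of v15 is replaced by the single classical named fact `stub_infiniteVolume : ricciNonneg_infiniteVolume`
(Calabi–Yau 1976: complete noncompact `Ric ≥ 0` ⇒ infinite volume). Stubs open after v16: `stub_infiniteVolume`,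
`stub_splittingAtInfinity` (16588), `stub_conicalGap` (16589), `stub_unboundedCurvatureGap` (16590).

v15 (2026-08-17): v15 RESHAPES v14 at the 3-d rung. Input (F1)
of `ThreeShrinker.modelData_of_curvature_inputs` — complete three-dimensional gradient shrinkers have `sect ≥ 0`, hence
`Ric ≥ 0` (B.-L. Chen 2009, Cor. 2.4) — is now a THEOREM of the tree
(`Literature.Geometry.Riemannian.ThreeShrinker.ricci_nonneg`, `…two_mul_ricci_le_scalarCurvature`,
Literature/Geometry/Riemannian/ThreeShrinkerSectionalNonneg.lean, p131605; elliptic Hamilton–Ivey maximum principle, ten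
Literature files of this cycle), so the classification fact follows from (F2) alone
(`threeShrinkerClassification_modelData_of_F2`, p131708) and the registered helper
`helper_threeShrinkerGap_of_F2 : F2 → ThreeShrinkerGap` (Theorems/…ThreeShrinkerRicciNonneg.lean) turns
`stub_threeShrinkerGap` into a THEOREM MODULO the new, strictly smaller registered stub `stub_F2` = Munteanu–Wang 2017,
Thm. 2, contrapositive, n = 3: "a complete connected normalised NONCOMPACT 3-d gradient shrinker with `R > 0` has a null
vector of `Ric`" (its proof in print: `Ric ≥ b/f` by an elliptic minimum principle, `S ≥ b ln f` along `∇f`, contradiction by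
volume comparison). Stubs open after v15: `stub_F2`, `stub_splittingAtInfinity` (16588), `stub_conicalGap` (16589),
`stub_unboundedCurvatureGap` (16590); `sorry` lives only in these four; `NoncompactShrinkerGap_of` is unchanged.

History. Lead c9 (`prover-line-stmt-SmoothPoincare4-10868-c9-0`, 2026-08-16): v14 = v13 with the stub `stub_compactSupportLSI`
PROVED (`exact` the landed `…Theorems.NoncompactShrinkerGapHeat.stub_compactSupportLSI`,
Theorems/EntropyRungNoncompactShrinkerGapStubCompactSupportLSIHeat.lean: the Bakry–Émery heat-flow proof on the
complete shrinker, 27 helper files of leads c8/c9). Four stubs remain, all of them route items with their own seats: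
16586 `ThreeShrinkerGap`, 16588 `ShrinkerSplittingAtInfinity`, 16589 `ConicalGap`, 16590 `UnboundedCurvatureGap`.

History (lead c8, `prover-line-stmt-SmoothPoincare4-10868-c8-0`, 2026-08-16). v13 RESHAPES v12 at one stub: the lever
`collapsedDirectionReduction_of_textbook` (Theorems/EntropyRungNoncompactShrinkerGapReductionTextbook.lean, p116509)
consumes the general Bakry–Émery item `BakryEmeryLogSobolev` (stmt-16587: the textbook LSI of EVERY complete
`CD(K,∞)` weighted manifold — XL) at exactly one place, the logarithmic Sobolev inequality for COMPACTLY SUPPORTED test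
functions on the complete 4-d shrinker (`stub_compactSupportLSI_of_lsi … w hws hwc hwZ`). v13 registers that strictly
weaker statement as the stub `stub_compactSupportLSI` (the v2 signature `Sig.stub_compactSupportLSI`, verbatim the
conclusion of the landed U1 `stub_compactSupportLSI_of_lsi`) in place of `stub_bakryEmeryLogSobolev`, and re-derives the
composition (`collapsedDirectionReduction_of_csLSI`, `nonDecayingGap_of_csLSI`, `NoncompactShrinkerGap_of`, sorry-free,
copies of the landed lever / glue with the one call replaced). The lead proves `stub_compactSupportLSI` in-session by
the Bakry–Émery heat-flow argument run on the complete shrinker (cut-offs θ(f/k)); the other four stubs are the route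
items 16586 / 16588 / 16589 / 16590 by name, unchanged from v12.

`sorry` lives ONLY in the three route-item `stub_*` theorems below (16588, 16589, 16590); `NoncompactShrinkerGap_of` concludes the crux BY NAME.
-/

noncomputable section

set_option linter.dupNamespace false

open scoped Manifold ContDiff ENNReal NNReal Topology
open MeasureTheory Set Filter
open Literature.Geometry.Lorentzian Literature.Geometry.Riemannian

namespace Summit.SmoothPoincare4.SmoothPoincare4.Cruxes.NoncompactShrinkerGap.CollapsedEndsUsc

open Summit.SmoothPoincare4.SmoothPoincare4.Theses.EntropyRung
open Summit.SmoothPoincare4.SmoothPoincare4.Theorems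
open Summit.SmoothPoincare4.SmoothPoincare4.Theorems.NoncompactShrinkerGapReduction
open Summit.SmoothPoincare4.SmoothPoincare4.Theorems.NoncompactShrinkerGapReductionTextbook

/-! ## Registered stubs (v17: three open — 16588, 16589, 16590; `stub_infiniteVolume` and `stub_threeShrinkerGap` are theorems) -/

/-- Calabi–Yau 1976 — PROVED (v17): a complete connected noncompact Riemannian manifold with `Ric ≥ 0` has
infinite volume, `Literature.Geometry.Riemannian.ricciNonneg_infiniteVolume_holds` (Bishop–Gromov; also
`ricciNonneg_infiniteVolume_of_antitone antitoneOn_jacobian_expMap_of_ricci_nonneg`, this line's homothety proof). -/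
theorem stub_infiniteVolume : Literature.Geometry.Riemannian.ricciNonneg_infiniteVolume :=
  Literature.Geometry.Riemannian.ricciNonneg_infiniteVolume_holds

/-- F3 / item stmt-SmoothPoincare4-16586 — the rung one dimension down — an UNCONDITIONAL THEOREM (v17): (F1) `sect ≥ 0`
(elliptic Hamilton–Ivey), the three steps of (F2) = Munteanu–Wang 2017 Thm 2 (`Ric ≥ c/f`, `R ≥ c log(f/ρ)`, finite volume) and
Calabi–Yau's infinite volume are theorems of the tree; the registered helper `helper_threeShrinkerGap_of_infiniteVolume` assembles
them. -/
theorem stub_threeShrinkerGap : Summit.SmoothPoincare4.SmoothPoincare4.Theses.EntropyRung.ThreeShrinkerGap :=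
  NoncompactShrinkerGapThreeShrinkerRicci.helper_threeShrinkerGap_of_infiniteVolume stub_infiniteVolume

/-- F1 / item stmt-SmoothPoincare4-16588 — splitting at infinity of a bounded-curvature non-conical end.
Closes by `exact ShrinkerSplittingAtInfinity_holds`. Chain step 1 (bounded `S` ⇒ bounded `|Ric|`, `|Rm|`) is
`FourShrinker.curvNormSq_bounded` (MW15 Thm 1.4, landed by lead c14); steps 2–4 (soliton flow, compactness, EMT limit,
Naber splitting) are not in the tree. -/
theorem stub_splittingAtInfinity :
    Summit.SmoothPoincare4.SmoothPoincare4.Theses.EntropyRung.ShrinkerSplittingAtInfinity := by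
  sorry

/-- CS-LSI — PROVED (v14): the logarithmic Sobolev inequality of the shrinker measure `e^{-f} dV` (constant
`4 = 2/K`, `K = ½`) for COMPACTLY SUPPORTED smooth test functions on a complete connected normalised 4-d gradient
shrinker, in Perelman's `𝒲`-form `log Θ ≤ 𝒲(g, w, 1)` — the landed
`Summit.SmoothPoincare4.SmoothPoincare4.Theorems.NoncompactShrinkerGapHeat.stub_compactSupportLSI`
(Bakry–Émery heat flow on the complete shrinker; leads c8/c9). -/
theorem stub_compactSupportLSI : ∀ (M : Type) [TopologicalSpace M] [T2Space M] [SecondCountableTopology M] [ChartedSpace (EuclideanSpace ℝ (Fin 4)) M] [IsManifold (𝓡 4) ∞ M] [ConnectedSpace M] [T3Space M] [MeasurableSpace M] [BorelSpace M] (g : PseudoRiemannianMetric (𝓡 4) ∞ (EuclideanSpace ℝ (Fin 4)) (TangentSpace (𝓡 4) : M → Type _)) [g.HasLeviCivita] (f : M → ℝ) (hg : g.IsRiemannian), (∀ (x : M) (r : NNReal), IsCompact {y : M | g.edist hg x y ≤ r}) → ContMDiff (𝓡 4) 𝓘(ℝ, ℝ) ∞ f → (∀ (x : M) (X Y : TangentSpace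 (𝓡 4) x), g.ricci x X Y + g.hessian f x X Y = (1 / 2 : ℝ) * g.val x X Y) → (∀ x : M, g.scalarCurvature x + g.gradSq f x = f x) → (∃ C : ℝ, ∀ x : M, g.scalarCurvature x ≤ C) → ∀ w : M → ℝ, ContMDiff (𝓡 4) 𝓘(ℝ, ℝ) ∞ w → HasCompactSupport w → 0 < ∫ x, w x ^ 2 ∂g.riemVolume → Real.log ((4 * Real.pi) ^ (-(4 : ℝ) / 2) * ∫ x, Real.exp (-f x) ∂g.riemVolume) ≤ (∫ x, (g.scalarCurvature x * w x ^ 2 + 4 * g.gradSq w x - w x ^ 2 * Real.log (w x ^ 2)) ∂g.riemVolume) / (∫ x, w x ^ 2 ∂g.riemVolume) + Real.log (∫ x, w x ^ 2 ∂g.riemVolume) - Real.log ((4 * Real.pi) ^ 2) - 4 :=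
  Summit.SmoothPoincare4.SmoothPoincare4.Theorems.NoncompactShrinkerGapHeat.stub_compactSupportLSI

/-- Residue 1 / item stmt-SmoothPoincare4-16589 — the density gap on the asymptotically conical class. OPEN PROBLEM.
Closes by `exact ConicalGap_holds`. -/
theorem stub_conicalGap : Summit.SmoothPoincare4.SmoothPoincare4.Theses.EntropyRung.ConicalGap := by
  sorry

/-- Residue 2 / item stmt-SmoothPoincare4-16590 — the density gap when `sup R = ∞`. No theorem in print.
Closes by `exact UnboundedCurvatureGap_holds`. -/
theorem stub_unboundedCurvatureGap :
    Summit.SmoothPoincare4.SmoothPoincare4.Theses.EntropyRung.UnboundedCurvatureGap := by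
  sorry

/-! ## The composition (sorry-free; concludes the crux BY NAME) -/

/-- **The lever keyed by the compact-support LSI** (copy of the landed `collapsedDirectionReduction_of_textbook` with the
single use of the textbook LSI — `stub_compactSupportLSI_of_lsi hX hCNff … w hws hwc hwZ` — replaced by the stub
`hCS … w hws hwc hwZ`): for a complete connected non-compact non-flat normalised 4-d shrinker with bounded non-decaying
scalar curvature there is a complete connected non-flat normalised 3-d shrinker `(N, h, φ)` with
`∫_M e^{-f} ≤ 2√π ∫_N e^{-φ}`. [cite: BernsteinWang2016, Thm 1.2, Cor 6.6] -/
theorem collapsedDirectionReduction_of_csLSI (hsplit : shrinkerSplittingAtInfinity_four)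
    (hCS : ∀ (M : Type) [TopologicalSpace M] [T2Space M] [SecondCountableTopology M] [ChartedSpace (EuclideanSpace ℝ (Fin 4)) M] [IsManifold (𝓡 4) ∞ M] [ConnectedSpace M] [T3Space M] [MeasurableSpace M] [BorelSpace M] (g : PseudoRiemannianMetric (𝓡 4) ∞ (EuclideanSpace ℝ (Fin 4)) (TangentSpace (𝓡 4) : M → Type _)) [g.HasLeviCivita] (f : M → ℝ) (hg : g.IsRiemannian), (∀ (x : M) (r : NNReal), IsCompact {y : M | g.edist hg x y ≤ r}) → ContMDiff (𝓡 4) 𝓘(ℝ, ℝ) ∞ f → (∀ (x : M) (X Y : TangentSpace (𝓡 4) x), g.ricci x X Y + g.hessian f x X Y = (1 / 2 : ℝ) * g.val x X Y) → (∀ x : M, g.scalarCurvature x + g.gradSq f x = f x) → (∃ C : ℝ, ∀ x : M, g.scalarCurvature x ≤ C) → ∀ w : M → ℝ, ContMDiff (𝓡 4) 𝓘(ℝ, ℝ) ∞ w → HasCompactSupport w → 0 < ∫ x, w x ^ 2 ∂g.riemVolume → Real.log ((4 * Real.pi) ^ (-(4 : ℝ) / 2) * ∫ x, Real.exp (-f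 x) ∂g.riemVolume) ≤ (∫ x, (g.scalarCurvature x * w x ^ 2 + 4 * g.gradSq w x - w x ^ 2 * Real.log (w x ^ 2)) ∂g.riemVolume) / (∫ x, w x ^ 2 ∂g.riemVolume) + Real.log (∫ x, w x ^ 2 ∂g.riemVolume) - Real.log ((4 * Real.pi) ^ 2) - 4)
    (M : Type) [TopologicalSpace M] [T2Space M] [SecondCountableTopology M]
    [ChartedSpace (EuclideanSpace ℝ (Fin 4)) M] [IsManifold (𝓡 4) ∞ M] [ConnectedSpace M] [NoncompactSpace M]
    [T3Space M] [MeasurableSpace M] [BorelSpace M]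
    (g : PseudoRiemannianMetric (𝓡 4) ∞ (EuclideanSpace ℝ (Fin 4)) (TangentSpace (𝓡 4) : M → Type _))
    [g.HasLeviCivita] (f : M → ℝ) (hg : g.IsRiemannian)
    (hc : ∀ (x : M) (r : NNReal), IsCompact {y : M | g.edist hg x y ≤ r})
    (hf : ContMDiff (𝓡 4) 𝓘(ℝ, ℝ) ∞ f)
    (hsol : ∀ (x : M) (X Y : TangentSpace (𝓡 4) x),
      g.ricci x X Y + g.hessian f x X Y = (1 / 2 : ℝ) * g.val x X Y)
    (hnorm : ∀ x : M, g.scalarCurvature x + g.gradSq f x = f x)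
    (hnf : ∃ x : M, g.scalarCurvature x ≠ 0)
    (hbdd : ∃ C : ℝ, ∀ x : M, g.scalarCurvature x ≤ C)
    (hnd : ∃ ε : ℝ, 0 < ε ∧ ∀ K : Set M, IsCompact K → ∃ x, x ∉ K ∧ ε ≤ g.scalarCurvature x) :
    ∃ (N : Type) (_ : TopologicalSpace N) (_ : T2Space N) (_ : SecondCountableTopology N)
      (_ : ChartedSpace (EuclideanSpace ℝ (Fin 3)) N) (_ : IsManifold (𝓡 3) ∞ N)
      (_ : ConnectedSpace N) (_ : T3Space N) (_ : MeasurableSpace N) (_ : BorelSpace N)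
      (h : PseudoRiemannianMetric (𝓡 3) ∞ (EuclideanSpace ℝ (Fin 3)) (TangentSpace (𝓡 3) : N → Type _))
      (_ : h.HasLeviCivita) (φ : N → ℝ) (hh : h.IsRiemannian),
      (∀ (y : N) (r : NNReal), IsCompact {z : N | h.edist hh y z ≤ r}) ∧
      ContMDiff (𝓡 3) 𝓘(ℝ, ℝ) ∞ φ ∧
      (∀ (y : N) (X Y : TangentSpace (𝓡 3) y),
        h.ricci y X Y + h.hessian φ y X Y = (1 / 2 : ℝ) * h.val y X Y) ∧
      (∀ y : N, h.scalarCurvature y + h.gradSq φ y = φ y) ∧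
      (∃ y : N, h.scalarCurvature y ≠ 0) ∧
      ∫⁻ x, ENNReal.ofReal (Real.exp (-f x)) ∂(riemannianMeasure (g.toContMDiffRiemannianMetric hg)) ≤
        ENNReal.ofReal (2 * Real.sqrt Real.pi) *
          ∫⁻ y, ENNReal.ofReal (Real.exp (-φ y)) ∂(riemannianMeasure (h.toContMDiffRiemannianMetric hh)) := by
  obtain ⟨N, tN, t2N, scN, chN, mN, cN, t3N, msN, bN, h, lcN, φ, hh, hcN, hφ, hsolN, hnormN, hnfN,
    htrans⟩ := hsplit M g f hg hc hf hsol hnorm hnf hbdd hnd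
  refine ⟨N, tN, t2N, scN, chN, mN, cN, t3N, msN, bN, h, lcN, φ, hh, hcN, hφ, hsolN, hnormN, hnfN, ?_⟩
  have hX := shrinkerScalarCurvature_nonneg_holds
  -- Carrillo–Ni (i) on `M` (`n = 4`) and on `N` (`n = 3`) — theorems
  have hAi : Integrable (fun x ↦ Real.exp (-f x)) g.riemVolume :=
    NoncompactShrinkerGapCarrilloNiClauses.carrilloNi_integrable_exp_neg g f hg hc hf hsol hnorm
  have hBi : Integrable (fun y ↦ Real.exp (-φ y)) h.riemVolume :=
    NoncompactShrinkerGapCarrilloNiClauses.carrilloNi_integrable_exp_neg h φ hh hcN hφ hsolN hnormN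
  have hApos : 0 < ∫ x, Real.exp (-f x) ∂g.riemVolume := integral_exp_neg_pos hg hAi
  have hBpos : 0 < ∫ y, Real.exp (-φ y) ∂h.riemVolume := integral_exp_neg_pos hh hBi
  have h2sqrtpi : 0 < 2 * Real.sqrt Real.pi := by positivity
  have hapos : 0 < (4 * Real.pi) ^ (-(4 : ℝ) / 2) := Real.rpow_pos_of_pos (by positivity) _
  -- the real inequality `∫_M e^{-f} ≤ 2√π ∫_N e^{-φ}` from CS-LSI, U2, U3, `ε` at a time
  have hmain : ∫ x, Real.exp (-f x) ∂g.riemVolume ≤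
      2 * Real.sqrt Real.pi * ∫ y, Real.exp (-φ y) ∂h.riemVolume := by
    refine le_of_forall_log_mul_le hapos hApos (mul_pos h2sqrtpi hBpos) fun ε hε ↦ ?_
    obtain ⟨R, W, hWs, hWc, hWsupp, hWZ, hWval⟩ :=
      NoncompactShrinkerGapModelValueSplitLineOfNonneg.stub_modelValueSplitLine_of_nonneg hX N h φ hh hcN hφ
        hsolN hnormN ε hε
    obtain ⟨η, hη, hη'⟩ :=
      NoncompactShrinkerGapTransplantComparison.stub_transplantComparison M g hg N h hh φ R W hWs hWc hWsupp
        hWZ ε hε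
    obtain ⟨U, Φ, Ψ, hU, hsub, hΦ, hΦU, hΨ, hinv, hqi, hscal⟩ := htrans R η hη
    obtain ⟨w, hws, hwc, hwZ, hwval⟩ := hη' U Φ Ψ hU hsub hΦ hΦU hΨ hinv hqi hscal
    have h1 := hCS M g f hg hc hf hsol hnorm hbdd w hws hwc hwZ
    linarith
  -- conversion to the route's `lintegral`s
  rw [lintegral_exp_neg_eq_ofReal_integral hg hAi, lintegral_exp_neg_eq_ofReal_integral hh hBi,
    ← ENNReal.ofReal_mul h2sqrtpi.le]
  exact ENNReal.ofReal_le_ofReal hmain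

/-- **The crux on the bounded-curvature non-conical class over the v13 stubs**: the 3-d rung `ThreeShrinkerGap`
composed with the lever `collapsedDirectionReduction_of_csLSI`: `∫_M e^{-f} ≤ 2√π · 16π² e^{-3/2} = 32π²√π e^{-3/2}`.
[cite: BernsteinWang2016, Thm 1.2] -/
theorem nonDecayingGap_of_csLSI (hT : ThreeShrinkerGap) (hsplit : ShrinkerSplittingAtInfinity)
    (hCS : ∀ (M : Type) [TopologicalSpace M] [T2Space M] [SecondCountableTopology M] [ChartedSpace (EuclideanSpace ℝ (Fin 4)) M] [IsManifold (𝓡 4) ∞ M] [ConnectedSpace M] [T3Space M] [MeasurableSpace M] [BorelSpace M] (g : PseudoRiemannianMetric (𝓡 4) ∞ (EuclideanSpace ℝ (Fin 4)) (TangentSpace (𝓡 4) : M → Type _)) [g.HasLeviCivita] (f : M → ℝ) (hg : g.IsRiemannian), (∀ (x : M) (r : NNReal), IsCompact {y : M | g.edist hg x y ≤ r}) → ContMDiff (𝓡 4) 𝓘(ℝ, ℝ) ∞ f → (∀ (x : M) (X Y : TangentSpace (𝓡 4) x), g.ricci x X Y + g.hessian f x X Y = (1 / 2 : ℝ) * g.val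 x X Y) → (∀ x : M, g.scalarCurvature x + g.gradSq f x = f x) → (∃ C : ℝ, ∀ x : M, g.scalarCurvature x ≤ C) → ∀ w : M → ℝ, ContMDiff (𝓡 4) 𝓘(ℝ, ℝ) ∞ w → HasCompactSupport w → 0 < ∫ x, w x ^ 2 ∂g.riemVolume → Real.log ((4 * Real.pi) ^ (-(4 : ℝ) / 2) * ∫ x, Real.exp (-f x) ∂g.riemVolume) ≤ (∫ x, (g.scalarCurvature x * w x ^ 2 + 4 * g.gradSq w x - w x ^ 2 * Real.log (w x ^ 2)) ∂g.riemVolume) / (∫ x, w x ^ 2 ∂g.riemVolume) + Real.log (∫ x, w x ^ 2 ∂g.riemVolume) - Real.log ((4 * Real.pi) ^ 2) - 4)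
    (M : Type) [TopologicalSpace M] [T2Space M] [SecondCountableTopology M]
    [ChartedSpace (EuclideanSpace ℝ (Fin 4)) M] [IsManifold (𝓡 4) ∞ M] [ConnectedSpace M] [NoncompactSpace M]
    [T3Space M] [MeasurableSpace M] [BorelSpace M]
    (g : PseudoRiemannianMetric (𝓡 4) ∞ (EuclideanSpace ℝ (Fin 4)) (TangentSpace (𝓡 4) : M → Type _))
    [g.HasLeviCivita] (f : M → ℝ) (hg : g.IsRiemannian)
    (hc : ∀ (x : M) (r : NNReal), IsCompact {y : M | g.edist hg x y ≤ r})
    (hf : ContMDiff (𝓡 4) 𝓘(ℝ, ℝ) ∞ f)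
    (hsol : ∀ (x : M) (X Y : TangentSpace (𝓡 4) x),
      g.ricci x X Y + g.hessian f x X Y = (1 / 2 : ℝ) * g.val x X Y)
    (hnorm : ∀ x : M, g.scalarCurvature x + g.gradSq f x = f x)
    (hnf : ∃ x : M, g.scalarCurvature x ≠ 0)
    (hbdd : ∃ C : ℝ, ∀ x : M, g.scalarCurvature x ≤ C)
    (hnd : ∃ ε : ℝ, 0 < ε ∧ ∀ K : Set M, IsCompact K → ∃ x, x ∉ K ∧ ε ≤ g.scalarCurvature x) :
    ∫⁻ x, ENNReal.ofReal (Real.exp (-f x)) ∂(riemannianMeasure (g.toContMDiffRiemannianMetric hg)) ≤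
      ENNReal.ofReal (32 * Real.pi ^ 2 * Real.sqrt Real.pi * Real.exp (-(3 : ℝ) / 2)) := by
  obtain ⟨N, _, _, _, _, _, _, _, _, _, h, _, φ, hh, hcN, hφ, hsolN, hnormN, hnfN, hZ⟩ :=
    collapsedDirectionReduction_of_csLSI (shrinkerSplittingAtInfinity_four_of_item hsplit) hCS M g f hg hc hf
      hsol hnorm hnf hbdd hnd
  have h3 : ∫⁻ x, ENNReal.ofReal (Real.exp (-φ x)) ∂(riemannianMeasure (h.toContMDiffRiemannianMetric hh))
      ≤ ENNReal.ofReal (16 * Real.pi ^ 2 * Real.exp (-(3 : ℝ) / 2)) :=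
    hT N h φ hh hcN hφ hsolN hnormN hnfN
  calc ∫⁻ x, ENNReal.ofReal (Real.exp (-f x)) ∂(riemannianMeasure (g.toContMDiffRiemannianMetric hg))
      ≤ ENNReal.ofReal (2 * Real.sqrt Real.pi) * ∫⁻ x, ENNReal.ofReal (Real.exp (-φ x))
          ∂(riemannianMeasure (h.toContMDiffRiemannianMetric hh)) := hZ
    _ ≤ ENNReal.ofReal (2 * Real.sqrt Real.pi) * ENNReal.ofReal (16 * Real.pi ^ 2 * Real.exp (-(3 : ℝ) / 2)) := by
        gcongr
    _ = ENNReal.ofReal (32 * Real.pi ^ 2 * Real.sqrt Real.pi * Real.exp (-(3 : ℝ) / 2)) :=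
        lineFactor_mul_threeBound

/-- **The crux from the five v13 inputs as hypotheses** (generic form of the composition): trichotomy on the scalar
curvature at infinity — unbounded `R` ↦ residue 2; bounded decaying `R` ↦ residue 1; bounded non-decaying `R` ↦
splitting at infinity + the compact-support LSI on the shrinker + the 3-d rung. -/
theorem noncompactShrinkerGap_of_csLSI
    (hT : Summit.SmoothPoincare4.SmoothPoincare4.Theses.EntropyRung.ThreeShrinkerGap)
    (hS : Summit.SmoothPoincare4.SmoothPoincare4.Theses.EntropyRung.ShrinkerSplittingAtInfinity)
    (hCS : ∀ (M : Type) [TopologicalSpace M] [T2Space M] [SecondCountableTopology M] [ChartedSpace (EuclideanSpace ℝ (Fin 4)) M] [IsManifold (𝓡 4) ∞ M] [ConnectedSpace M] [T3Space M] [MeasurableSpace M] [BorelSpace M] (g : PseudoRiemannianMetric (𝓡 4) ∞ (EuclideanSpace ℝ (Fin 4)) (TangentSpace (𝓡 4) : M → Type _)) [g.HasLeviCivita] (f : M → ℝ) (hg : g.IsRiemannian), (∀ (x : M) (r : NNReal), IsCompact {y : M | g.edist hg x y ≤ r}) → ContMDiff (𝓡 4) 𝓘(ℝ, ℝ) ∞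 f → (∀ (x : M) (X Y : TangentSpace (𝓡 4) x), g.ricci x X Y + g.hessian f x X Y = (1 / 2 : ℝ) * g.val x X Y) → (∀ x : M, g.scalarCurvature x + g.gradSq f x = f x) → (∃ C : ℝ, ∀ x : M, g.scalarCurvature x ≤ C) → ∀ w : M → ℝ, ContMDiff (𝓡 4) 𝓘(ℝ, ℝ) ∞ w → HasCompactSupport w → 0 < ∫ x, w x ^ 2 ∂g.riemVolume → Real.log ((4 * Real.pi) ^ (-(4 : ℝ) / 2) * ∫ x, Real.exp (-f x) ∂g.riemVolume) ≤ (∫ x, (g.scalarCurvature x * w x ^ 2 + 4 * g.gradSq w x - w x ^ 2 * Real.log (w x ^ 2)) ∂g.riemVolume) / (∫ x, w x ^ 2 ∂g.riemVolume) + Real.log (∫ x, w x ^ 2 ∂g.riemVolume) - Real.log ((4 * Real.pi) ^ 2) - 4)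
    (hC : Summit.SmoothPoincare4.SmoothPoincare4.Theses.EntropyRung.ConicalGap)
    (hD : Summit.SmoothPoincare4.SmoothPoincare4.Theses.EntropyRung.UnboundedCurvatureGap) :
    Summit.SmoothPoincare4.SmoothPoincare4.Theses.EntropyRung.NoncompactShrinkerGap := by
  intro M _ _ _ _ _ _ _ _ _ _ g _ f hg hc hf hsol hnorm hnf
  by_cases hbdd : ∃ C : ℝ, ∀ x : M, g.scalarCurvature x ≤ C
  · by_cases hflat : ∀ ε : ℝ, 0 < ε → ∃ K : Set M, IsCompact K ∧ ∀ x, x ∉ K → g.scalarCurvature x < ε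
    · exact hC M g f hg hc hf hsol hnorm hnf hflat
    · exact nonDecayingGap_of_csLSI hT hS hCS M g f hg hc hf hsol hnorm hnf hbdd
        (exists_nondecaying_of_not_flatAtInfinity hflat)
  · exact hD M g f hg hc hf hsol hnorm hnf hbdd

/-- **`NoncompactShrinkerGap_of`** (v14): the crux BY NAME from the registered stubs (used by name inside the
proof, as the skeleton checker requires): `noncompactShrinkerGap_of_csLSI` fed with `stub_threeShrinkerGap`,
`stub_splittingAtInfinity`, `stub_compactSupportLSI`, `stub_conicalGap`, `stub_unboundedCurvatureGap`. -/
theorem NoncompactShrinkerGap_of :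
    Summit.SmoothPoincare4.SmoothPoincare4.Theses.EntropyRung.NoncompactShrinkerGap :=
  noncompactShrinkerGap_of_csLSI stub_threeShrinkerGap stub_splittingAtInfinity stub_compactSupportLSI
    stub_conicalGap stub_unboundedCurvatureGap

end Summit.SmoothPoincare4.SmoothPoincare4.Cruxes.NoncompactShrinkerGap.CollapsedEndsUsc

end
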